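import Summits.KontsevichZagierPeriods.KontsevichZagierPeriods.Theorems.RootDecompQuadraticDescentPair18HomotopyAngP07

/-! # `RootDecompQuadraticDescentPair18HomotopyAngP08` — part 8/20 of the mechanical ≤400-line split of `Pair18HomotopyAng_v13_landing.lean` (sha256 01bf0af4c8d09f43…)
Source: decomp-kz lens-6 g9 `Pair18HomotopyAng.lean` v13 (HOME/decomp-kz-lens-6/g9/, sha256 bd7fcda1…; critic g5 19:35:56Z CLEARED «angle side of #18 PROVED»: hTh7_holds, hB17_holds, hAng4_holds with no hypotheses) — companion file #2 of Pair18Homotopy v14 (landed as …Pair18HomotopyP01–P31): the verbatim COPIED PRELUDE is dropped in favour of those landed declarations, the four homonyms with different bodies are renamed (Th7_eq', TriA, isSemialgebraic_TriA, volume_diag'), `#print axioms` pins removed.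
Split by census-1 g9 `gen/splitlean.py`: scopes re-opened with their `open`/`variable`/`set_option` context; mathematics and declaration order unchanged. -/

set_option linter.unusedSimpArgs false
noncomputable section
open _root_.Set MvPolynomial
namespace Summit.KontsevichZagierPeriods.RootDecompQuadraticDescent.Pair18Homotopy
open Literature.NumberTheory.Transcendental
open Literature.NumberTheory.Transcendental.KZ (RFun cube)
open Summit.KontsevichZagierPeriods.RootDecompQuadraticDescent.DarkPairs (rel_reflect_rep rel_double)
section Fold
open Literature.ModelTheory.ExponentialFields (IsSemialgebraic isSemialgebraic_setOf_eval_le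
  isSemialgebraic_setOf_eval_pos isSemialgebraic_setOf_eval_nonneg isSemialgebraic_setOf_eval_eq_zero)

open _root_.Set MvPolynomial in
open Literature.NumberTheory.Transcendental in
open Literature.NumberTheory.Transcendental.KZ (RFun cube) in
open Summit.KontsevichZagierPeriods.RootDecompQuadraticDescent.DarkPairs (rel_reflect_rep rel_double) in
/-- Auxiliary step `cube2` (§0): cube2. [bookkeeping] -/
private theorem cube2 {x : Fin 2 → ℝ} (hx : x ∈ KZ.cube 2) : (0 ≤ x 0 ∧ x 0 ≤ 1) ∧ (0 ≤ x 1 ∧ x 1 ≤ 1) := ⟨hx 0, hx 1⟩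

/-- **hAng4, all curved pieces straightened**: the left side of `hAng4` equals, modulo KZ-relations, the six
LINE-or-`Q'²(1+2P'²)=1`-bounded angle cells
`[AngH|RM⁻] + [AngH|RM_rect] + [AngH|RM_cap'] + [AngH|U₊'] + [AngH|U₋'⁺] + [AngH|Ũ₋']`,
where `U₊' ∪ U₋'⁺ ∪ RM_cap'` tiles `{0 ≤ φ' ≤ θ−α₁, max(0, φ'−α₁) ≤ v' ≤ min(φ'+α₁, θ−α₁)}` (curve interior). -/
theorem hAng4_pieces :
    KZ.of AngHM + KZ.of AngHp + KZ.of AngHm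
      - KZ.of AngHMneg - KZ.of AngHMrect - KZ.of AngHMcapI - KZ.of AngHUp - KZ.of AngHUm - KZ.of AngHUmr ∈
      KZ.relations := by
  have h := add_mem (add_mem (add_mem AngHM_cut0 AngHMpos_cut) AngHMcap_inv) AngHpm_transport
  convert h using 1
  abel

/-! ### §19i  hAng4 bookkeeping, first cells: the `φ' = α₁` cuts of `U₊'`, `U₋'⁺` and the trapezoid
`Trap' = {0 ≤ φ' ≤ α₁, 0 ≤ v' ≤ φ'+α₁} = Trap'_lo ⊔ Trap'_hi` (split along `v' = φ'`)

Below `φ' = α₁` the curve constraint `Q'²(1+2P'²) ≤ 1` of `U₊'`, `U₋'⁺` is REDUNDANT (it touches only at the corner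
`(α₁, 2α₁)`, `tan 2α₁ = √7/3`): `U₊' ∩ {7P'² ≤ 1} = Trap'_lo = {0 ≤ v' ≤ φ' ≤ α₁}` and
`U₋'⁺ ∩ {7P'² ≤ 1} = Trap'_hi = {0 ≤ φ' ≤ α₁, φ' ≤ v' ≤ φ'+α₁}` — pure LINE cells. -/

/-- Auxiliary definition `sK2c` (§19i): s K2c. [bookkeeping] -/
def sK2c : Set (Fin 2 → ℝ) := {z | 1 ≤ 28 * z 0 * z 0}
/-- Auxiliary definition `UPlo` (§19i): UPlo. [bookkeeping] -/
def UPlo : Set (Fin 2 → ℝ) := UP ∩ sK2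
/-- Auxiliary definition `UPhi` (§19i): UPhi. [bookkeeping] -/
def UPhi : Set (Fin 2 → ℝ) := UP ∩ sK2c
/-- Auxiliary definition `UMlo` (§19i): UMlo. [bookkeeping] -/
def UMlo : Set (Fin 2 → ℝ) := UM ∩ sK2
/-- Auxiliary definition `UMhi` (§19i): UMhi. [bookkeeping] -/
def UMhi : Set (Fin 2 → ℝ) := UM ∩ sK2c
/-- Auxiliary step `isSemialgebraic_sK2` (§19i): is Semialgebraic s K2. [bookkeeping] -/
theorem isSemialgebraic_sK2 : IsSemialgebraic ℚ sK2 :=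
  isSemialgebraic_of_le (C 28 * X 0 * X 0) (C 1) sK2 fun z => by
    simp only [sK2, mem_setOf_eq, map_mul, aeval_C, aeval_X, eq_ratCast, Rat.cast_ofNat, Rat.cast_one]
/-- Auxiliary step `isSemialgebraic_sK2c` (§19i): is Semialgebraic s K2c. [bookkeeping] -/
theorem isSemialgebraic_sK2c : IsSemialgebraic ℚ sK2c :=
  isSemialgebraic_of_le (C 1) (C 28 * X 0 * X 0) sK2c fun z => by
    simp only [sK2c, mem_setOf_eq, map_mul, aeval_C, aeval_X, eq_ratCast, Rat.cast_ofNat, Rat.cast_one]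
/-- Auxiliary definition `AngHUplo` (§19i): Ang HUplo. [bookkeeping] -/
def AngHUplo : KZ.IntegralRep 2 := AngH.rep.restrict UPlo (isSemialgebraic_UP.inter isSemialgebraic_sK2) (fun _ hz => hz.1.1)
/-- Auxiliary definition `AngHUphi` (§19i): Ang HUphi. [bookkeeping] -/
def AngHUphi : KZ.IntegralRep 2 := AngH.rep.restrict UPhi (isSemialgebraic_UP.inter isSemialgebraic_sK2c) (fun _ hz => hz.1.1)
/-- Auxiliary definition `AngHUmlo` (§19i): Ang HUmlo. [bookkeeping] -/
def AngHUmlo : KZ.IntegralRep 2 := AngH.rep.restrict UMlo (isSemialgebraic_UM.inter isSemialgebraic_sK2) (fun _ hz => hz.1.1)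
/-- Auxiliary definition `AngHUmhi` (§19i): Ang HUmhi. [bookkeeping] -/
def AngHUmhi : KZ.IntegralRep 2 := AngH.rep.restrict UMhi (isSemialgebraic_UM.inter isSemialgebraic_sK2c) (fun _ hz => hz.1.1)

/-- Auxiliary step `volume_sK2_line` (§19i): volume s K2 line. [bookkeeping] -/
theorem volume_sK2_line : MeasureTheory.volume {z : Fin 2 → ℝ | 28 * z 0 * z 0 = 1} = 0 := by
  have h := volume_setOf_aeval_eq_zero (k := ℚ) (m := 2) (C 28 * X 0 * X 0 - C 1 : MvPolynomial (Fin 2) ℚ) (by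
    intro h0
    have h1 := congr_arg (MvPolynomial.eval (fun _ => (0:ℝ))) h0
    simp at h1)
  have e : {x : Fin 2 → ℝ | aeval x (C 28 * X 0 * X 0 - C 1 : MvPolynomial (Fin 2) ℚ) = 0} =
      {z : Fin 2 → ℝ | 28 * z 0 * z 0 = 1} := by
    ext z
    simp only [mem_setOf_eq, map_sub, map_mul, aeval_C, aeval_X, eq_ratCast, Rat.cast_ofNat, Rat.cast_one,
      sub_eq_zero]
  rw [← e]; exact h

/-- `[AngH | U₊'] ≡ [AngH | U₊' ∩ {7P'² ≤ 1}] + [AngH | U₊' ∩ {7P'² ≥ 1}]`. -/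
theorem AngHUp_cut : KZ.of AngHUp - KZ.of AngHUplo - KZ.of AngHUphi ∈ KZ.relations :=
  rel_cut AngHUp AngHUplo AngHUphi (fun z => 28 * z 0 * z 0) 1 rfl rfl volume_sK2_line
    (fun _ _ => rfl) (fun _ _ => rfl)
/-- `[AngH | U₋'⁺] ≡ [AngH | U₋'⁺ ∩ {7P'² ≤ 1}] + [AngH | U₋'⁺ ∩ {7P'² ≥ 1}]`. -/
theorem AngHUm_cut : KZ.of AngHUm - KZ.of AngHUmlo - KZ.of AngHUmhi ∈ KZ.relations :=
  rel_cut AngHUm AngHUmlo AngHUmhi (fun z => 28 * z 0 * z 0) 1 rfl rfl volume_sK2_line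
    (fun _ _ => rfl) (fun _ _ => rfl)

/-- `Trap'_lo = {0 ≤ Q' ≤ P', 7P'² ≤ 1}` and `Trap'_hi = {P' ≤ Q' ≤ 1, 7(Q'−P')² ≤ (1+P'Q')², 7P'² ≤ 1}`. -/
def TrapLo : Set (Fin 2 → ℝ) := cube 2 ∩ (sU1 ∩ sU2 ∩ sK2)
/-- `{Q ≤ 1}` (the old `π/4` bound; redundant on `Trap'_hi` but kept in its definition). -/
def sQ1 : Set (Fin 2 → ℝ) := {z | 4 * z 1 ≤ 3}
/-- Auxiliary definition `TrapHi` (§19i): Trap Hi. [bookkeeping] -/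
def TrapHi : Set (Fin 2 → ℝ) := cube 2 ∩ (sU2m ∩ sU3 ∩ sQ1 ∩ sK2)
/-- Auxiliary step `isSemialgebraic_TrapLo` (§19i): is Semialgebraic Trap Lo. [bookkeeping] -/
theorem isSemialgebraic_TrapLo : IsSemialgebraic ℚ TrapLo := by
  refine KZ.isSemialgebraic_cube.inter (((?_ : IsSemialgebraic ℚ sU1).inter ?_).inter isSemialgebraic_sK2)
  · exact isSemialgebraic_of_le (C 2) (C 4 * X 1) sU1 fun z => by
      simp only [sU1, mem_setOf_eq, map_mul, aeval_C, aeval_X, eq_ratCast, Rat.cast_ofNat]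
  · exact isSemialgebraic_of_le (C 4 * X 1 - C 2) (C 2 * X 0) sU2 fun z => by
      simp only [sU2, mem_setOf_eq, map_mul, map_sub, aeval_C, aeval_X, eq_ratCast, Rat.cast_ofNat]
/-- Auxiliary step `isSemialgebraic_TrapHi` (§19i): is Semialgebraic Trap Hi. [bookkeeping] -/
theorem isSemialgebraic_TrapHi : IsSemialgebraic ℚ TrapHi := by
  refine KZ.isSemialgebraic_cube.inter ((((?_ : IsSemialgebraic ℚ sU2m).inter ?_).inter ?_).inter
    isSemialgebraic_sK2)
  · exact isSemialgebraic_of_le (C 2 * X 0) (C 4 * X 1 - C 2) sU2m fun z => by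
      simp only [sU2m, mem_setOf_eq, map_mul, map_sub, aeval_C, aeval_X, eq_ratCast, Rat.cast_ofNat]
  · exact isSemialgebraic_of_le (C 7 * ((C 2 * X 0 - (C 4 * X 1 - C 2)) * (C 2 * X 0 - (C 4 * X 1 - C 2))))
      ((C 1 + C 2 * X 0 * (C 4 * X 1 - C 2)) * (C 1 + C 2 * X 0 * (C 4 * X 1 - C 2))) sU3 fun z => by
      simp only [sU3, mem_setOf_eq, map_mul, map_sub, map_add, aeval_C, aeval_X, eq_ratCast, Rat.cast_ofNat,
        Rat.cast_one]
  · exact isSemialgebraic_of_le (C 4 * X 1) (C 3) sQ1 fun z => by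
      simp only [sQ1, mem_setOf_eq, map_mul, aeval_C, aeval_X, eq_ratCast, Rat.cast_ofNat]
/-- Auxiliary definition `AngHTrapLo` (§19i): Ang HTrap Lo. [bookkeeping] -/
def AngHTrapLo : KZ.IntegralRep 2 := AngH.rep.restrict TrapLo isSemialgebraic_TrapLo (fun _ hz => hz.1)
/-- Auxiliary definition `AngHTrapHi` (§19i): Ang HTrap Hi. [bookkeeping] -/
def AngHTrapHi : KZ.IntegralRep 2 := AngH.rep.restrict TrapHi isSemialgebraic_TrapHi (fun _ hz => hz.1)

/-- Auxiliary step `UPlo_eq_TrapLo` (§19i): UPlo eq Trap Lo. [bookkeeping] -/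
theorem UPlo_eq_TrapLo : UPlo = TrapLo := by
  ext z
  constructor
  · rintro ⟨⟨hc, ⟨⟨⟨⟨u1, u2⟩, -⟩, -⟩, -⟩⟩, k2⟩
    exact ⟨hc, ⟨⟨u1, u2⟩, k2⟩⟩
  · rintro ⟨hc, ⟨⟨u1, u2⟩, k2⟩⟩
    have h0 := (cube2 hc).1
    simp only [sU1, sU2, sK2, mem_setOf_eq] at u1 u2 k2
    have hQ0 : (0:ℝ) ≤ 4 * z 1 - 2 := by linarith
    refine ⟨⟨hc, ⟨⟨⟨⟨u1, u2⟩, ?_⟩, ?_⟩, by simp only [sRM2, mem_setOf_eq]; linarith⟩⟩, k2⟩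
    · simp only [sU3, mem_setOf_eq]
      nlinarith [mul_nonneg h0.1 hQ0, mul_nonneg hQ0 (sub_nonneg.2 u2), mul_nonneg h0.1 (sub_nonneg.2 u2)]
    · simp only [sU4, mem_setOf_eq]
      nlinarith [mul_nonneg hQ0 (sub_nonneg.2 u2), mul_nonneg h0.1 (sub_nonneg.2 u2), mul_nonneg h0.1 hQ0,
        mul_nonneg (mul_nonneg hQ0 hQ0) (sub_nonneg.2 k2), mul_nonneg (mul_self_nonneg (z 0)) (sub_nonneg.2 k2),
        mul_nonneg (mul_nonneg hQ0 (sub_nonneg.2 u2)) (mul_self_nonneg (z 0))]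
/-- Auxiliary step `UMlo_eq_TrapHi` (§19i): UMlo eq Trap Hi. [bookkeeping] -/
theorem UMlo_eq_TrapHi : UMlo = TrapHi := by
  ext z
  constructor
  · rintro ⟨⟨hc, ⟨⟨⟨u1, u2⟩, u3⟩, u4⟩⟩, k2⟩
    have h0 := (cube2 hc).1
    simp only [sU1, sU2m, sU4, sK2, mem_setOf_eq] at u1 u2 u4 k2
    have hQ0 : (0:ℝ) ≤ 4 * z 1 - 2 := by linarith
    refine ⟨hc, ⟨⟨⟨u2, u3⟩, ?_⟩, k2⟩⟩
    simp only [sQ1, mem_setOf_eq]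
    nlinarith [mul_nonneg (mul_nonneg hQ0 hQ0) (mul_self_nonneg (z 0))]
  · rintro ⟨hc, ⟨⟨⟨u2, u3⟩, i3⟩, k2⟩⟩
    have h0 := (cube2 hc).1
    simp only [sU2m, sU3, sQ1, sK2, mem_setOf_eq] at u2 u3 i3 k2
    have hp : (0:ℝ) ≤ 2 * z 0 := by linarith [h0.1]
    refine ⟨⟨hc, ⟨⟨⟨?_, u2⟩, u3⟩, ?_⟩⟩, k2⟩
    · simp only [sU1, mem_setOf_eq]; linarith
    · simp only [sU4, mem_setOf_eq]
      have hq1 : 4 * z 1 - 2 ≤ (1:ℝ) := by linarith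
      have h7 : 7 * ((2 * z 0) * (2 * z 0)) ≤ 1 := by linarith
      have h3 : 7 * (((4 * z 1 - 2) - 2 * z 0) * ((4 * z 1 - 2) - 2 * z 0)) ≤
          (1 + (2 * z 0) * (4 * z 1 - 2)) * (1 + (2 * z 0) * (4 * z 1 - 2)) := by nlinarith [u3]
      nlinarith [mul_nonneg hp (sub_nonneg.2 u2), mul_nonneg (sub_nonneg.2 u2) (sub_nonneg.2 hq1),
        mul_nonneg hp hp, mul_nonneg (mul_nonneg hp hp) (sub_nonneg.2 h7), mul_self_nonneg ((2 * z 0) * (4 * z 1 - 2)),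
        mul_nonneg (sub_nonneg.2 h7) (mul_self_nonneg (4 * z 1 - 2)), mul_nonneg (sub_nonneg.2 h3) hp]

/-- `[AngH | U₊' ∩ {7P'² ≤ 1}] ≡ [AngH | Trap'_lo]` (equal domains). -/
theorem AngHUplo_TrapLo : KZ.of AngHUplo - KZ.of AngHTrapLo ∈ KZ.relations :=
  KZ.of_sub_of_mem_relations_of_eqOn
    (by simp only [AngHTrapLo, AngHUplo, KZ.IntegralRep.domain_restrict, UPlo_eq_TrapLo]) (fun _ _ => rfl)
/-- `[AngH | U₋'⁺ ∩ {7P'² ≤ 1}] ≡ [AngH | Trap'_hi]` (equal domains; the curve constraint is redundant). -/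
theorem AngHUmlo_TrapHi : KZ.of AngHUmlo - KZ.of AngHTrapHi ∈ KZ.relations :=
  KZ.of_sub_of_mem_relations_of_eqOn
    (by simp only [AngHTrapHi, AngHUmlo, KZ.IntegralRep.domain_restrict, UMlo_eq_TrapHi]) (fun _ _ => rfl)

/-- **hAng4, state after g9**: modulo KZ-relations the left side `[AngH|RM] + [AngH|RK₊] + [AngH|RK₋]` of `hAng4`
is the sum of seven angle cells in ONE chart `(P', Q') = (2s, 4w−2)`: the line polygons `RM_low`
(`1 ≤ 7P² ≤ 9, −P ≤ Q ≤ 1`), `Trap'_lo`, `Trap'_hi`, `Ũ₋'` (a triangle `0 ≤ φ', 0 ≤ v', φ'+v' ≤ α₁` up to the redundant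
curve bound), and the three curve-bounded cells `RM_cap'`, `U₊' ∩ {7P'² ≥ 1}`, `U₋'⁺ ∩ {7P'² ≥ 1}` which tile the line
polygon `S' = {α₁ ≤ φ' ≤ θ−α₁, φ'−α₁ ≤ v' ≤ θ−α₁}` (curve interior). -/
theorem hAng4_cells :
    KZ.of AngHM + KZ.of AngHp + KZ.of AngHm
      - KZ.of AngHMneg - KZ.of AngHMrect - KZ.of AngHMcapI - KZ.of AngHTrapLo - KZ.of AngHUphi
      - KZ.of AngHTrapHi - KZ.of AngHUmhi - KZ.of AngHUmr ∈ KZ.relations := by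
  have h := add_mem (add_mem (add_mem (add_mem hAng4_pieces AngHUp_cut) AngHUm_cut) AngHUplo_TrapLo)
    AngHUmlo_TrapHi
  convert h using 1
  abel

/-! ### §19j  hAng4 bookkeeping, second cells: the upper polygon
`S'_hi = {α₁ ≤ φ' ≤ v' ≤ θ−α₁} = (U₋'⁺ ∩ {7P'² ≥ 1}) ⊔ (RM_cap' ∩ {v' ≥ φ'})` (glued along the curve)

and the diagonal cut `RM_cap' = RM_cap' ∩ {v' ≤ φ'} ⊔ RM_cap' ∩ {v' ≥ φ'}`.  The lower polygon
`S'_lo = {α₁ ≤ φ' ≤ θ−α₁, φ'−α₁ ≤ v' ≤ φ'} = (U₊' ∩ {7P'² ≥ 1}) ⊔ (RM_cap' ∩ {v' ≤ φ'})` is §19k: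
its one non-trivial inclusion is `RM_cap' ∩ {v' ≤ φ'} ⊆ {v' ≥ φ' − α₁}`, i.e. `κ'(φ') ≥ θ − 2α₁ ≥ φ' − α₁`, the
polynomial implication `1 ≤ 7p² ≤ 9, 0 ≤ q ≤ p, q²(1+2p²) ≥ 1 ⟹ 7(p−q)² ≤ (1+pq)²` (tight at `(3/√7, √7/5)`;
proof: the target is concave in `q`, holds at `q = p`, and at `q² = 1/(1+2p²)` it is `(3−x)(2x³+2x²+14x+14) ≥ 0`,
`x = √7·p`). -/

/-- Auxiliary definition `sDl` (§19j): s Dl. [bookkeeping] -/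
def sDl : Set (Fin 2 → ℝ) := {z | 4 * z 1 - 2 - 2 * z 0 ≤ 0}
/-- Auxiliary definition `sDu` (§19j): s Du. [bookkeeping] -/
def sDu : Set (Fin 2 → ℝ) := {z | 0 ≤ 4 * z 1 - 2 - 2 * z 0}
/-- Auxiliary definition `RMcapD` (§19j): RMcap D. [bookkeeping] -/
def RMcapD : Set (Fin 2 → ℝ) := RMcapI ∩ sDl
/-- Auxiliary definition `RMcapU` (§19j): RMcap U. [bookkeeping] -/
def RMcapU : Set (Fin 2 → ℝ) := RMcapI ∩ sDu
/-- Auxiliary step `isSemialgebraic_sDl` (§19j): is Semialgebraic s Dl. [bookkeeping] -/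
theorem isSemialgebraic_sDl : IsSemialgebraic ℚ sDl :=
  isSemialgebraic_of_le (C 4 * X 1 - C 2 - C 2 * X 0) (C 0) sDl fun z => by
    simp only [sDl, mem_setOf_eq, map_mul, map_sub, aeval_C, aeval_X, eq_ratCast, Rat.cast_ofNat, Rat.cast_zero]
/-- Auxiliary step `isSemialgebraic_sDu` (§19j): is Semialgebraic s Du. [bookkeeping] -/
theorem isSemialgebraic_sDu : IsSemialgebraic ℚ sDu :=
  isSemialgebraic_of_le (C 0) (C 4 * X 1 - C 2 - C 2 * X 0) sDu fun z => by
    simp only [sDu, mem_setOf_eq, map_mul, map_sub, aeval_C, aeval_X, eq_ratCast, Rat.cast_ofNat, Rat.cast_zero]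
/-- Auxiliary definition `AngHMcapD` (§19j): Ang HMcap D. [bookkeeping] -/
def AngHMcapD : KZ.IntegralRep 2 :=
  AngH.rep.restrict RMcapD (isSemialgebraic_RMcapI.inter isSemialgebraic_sDl) (fun _ hz => hz.1.1)
/-- Auxiliary definition `AngHMcapU` (§19j): Ang HMcap U. [bookkeeping] -/
def AngHMcapU : KZ.IntegralRep 2 :=
  AngH.rep.restrict RMcapU (isSemialgebraic_RMcapI.inter isSemialgebraic_sDu) (fun _ hz => hz.1.1)

/-- the diagonal cut `[AngH | RM_cap'] ≡ [AngH | RM_cap' ∩ {Q' ≤ P'}] + [AngH | RM_cap' ∩ {Q' ≥ P'}]`. -/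
theorem AngHMcapI_cut : KZ.of AngHMcapI - KZ.of AngHMcapD - KZ.of AngHMcapU ∈ KZ.relations := by
  have hnull : MeasureTheory.volume {z : Fin 2 → ℝ | 4 * z 1 - 2 - 2 * z 0 = 0} = 0 := by
    have h := volume_setOf_aeval_eq_zero (k := ℚ) (m := 2) (C 4 * X 1 - C 2 - C 2 * X 0 : MvPolynomial (Fin 2) ℚ)
      (by
        intro h0
        have h1 := congr_arg (MvPolynomial.eval (fun _ => (0:ℝ))) h0
        simp at h1)
    have e : {x : Fin 2 → ℝ | aeval x (C 4 * X 1 - C 2 - C 2 * X 0 : MvPolynomial (Fin 2) ℚ) = 0} =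
        {z : Fin 2 → ℝ | 4 * z 1 - 2 - 2 * z 0 = 0} := by
      ext z
      simp only [mem_setOf_eq, map_sub, map_mul, aeval_C, aeval_X, eq_ratCast, Rat.cast_ofNat]
    rw [← e]; exact h
  exact rel_cut AngHMcapI AngHMcapD AngHMcapU (fun z => 4 * z 1 - 2 - 2 * z 0) 0 rfl rfl hnull
    (fun _ _ => rfl) (fun _ _ => rfl)

/-- `S'_hi = {1 ≤ 7P'² ≤ 9, P' ≤ Q', 7Q'² ≤ 9}` (the lattice triangle `α₁ ≤ φ' ≤ v' ≤ θ − α₁`). -/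
def SHi : Set (Fin 2 → ℝ) := cube 2 ∩ (sRM1 ∩ sRM2 ∩ sU2m ∩ sI3)
/-- Auxiliary step `isSemialgebraic_SHi` (§19j): is Semialgebraic SHi. [bookkeeping] -/
theorem isSemialgebraic_SHi : IsSemialgebraic ℚ SHi := by
  refine KZ.isSemialgebraic_cube.inter ((((?_ : IsSemialgebraic ℚ sRM1).inter ?_).inter ?_).inter ?_)
  · exact isSemialgebraic_of_le (C 1) (C 28 * X 0 * X 0) sRM1 fun z => by
      simp only [sRM1, mem_setOf_eq, map_mul, aeval_C, aeval_X, eq_ratCast, Rat.cast_ofNat, Rat.cast_one]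
  · exact isSemialgebraic_of_le (C 28 * X 0 * X 0) (C 9) sRM2 fun z => by
      simp only [sRM2, mem_setOf_eq, map_mul, aeval_C, aeval_X, eq_ratCast, Rat.cast_ofNat]
  · exact isSemialgebraic_of_le (C 2 * X 0) (C 4 * X 1 - C 2) sU2m fun z => by
      simp only [sU2m, mem_setOf_eq, map_mul, map_sub, aeval_C, aeval_X, eq_ratCast, Rat.cast_ofNat]
  · exact isSemialgebraic_of_le (C 7 * ((C 4 * X 1 - C 2) * (C 4 * X 1 - C 2))) (C 9) sI3 fun z => by
      simp only [sI3, mem_setOf_eq, map_mul, map_sub, aeval_C, aeval_X, eq_ratCast, Rat.cast_ofNat]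
/-- Auxiliary definition `sU4c` (§19j): s U4c. [bookkeeping] -/
def sU4c : Set (Fin 2 → ℝ) := {z | 1 ≤ (4 * z 1 - 2) * (4 * z 1 - 2) * (1 + 8 * z 0 * z 0)}
/-- Auxiliary step `isSemialgebraic_sU4` (§19j): is Semialgebraic s U4. [bookkeeping] -/
theorem isSemialgebraic_sU4 : IsSemialgebraic ℚ sU4 :=
  isSemialgebraic_of_le ((C 4 * X 1 - C 2) * (C 4 * X 1 - C 2) * (C 1 + C 8 * X 0 * X 0)) (C 1) sU4 fun z => by
    simp only [sU4, mem_setOf_eq, map_mul, map_sub, map_add, aeval_C, aeval_X, eq_ratCast, Rat.cast_ofNat,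
      Rat.cast_one]
/-- Auxiliary step `isSemialgebraic_sU4c` (§19j): is Semialgebraic s U4c. [bookkeeping] -/
theorem isSemialgebraic_sU4c : IsSemialgebraic ℚ sU4c :=
  isSemialgebraic_of_le (C 1) ((C 4 * X 1 - C 2) * (C 4 * X 1 - C 2) * (C 1 + C 8 * X 0 * X 0)) sU4c fun z => by
    simp only [sU4c, mem_setOf_eq, map_mul, map_sub, map_add, aeval_C, aeval_X, eq_ratCast, Rat.cast_ofNat,
      Rat.cast_one]
/-- Auxiliary definition `SHiB` (§19j): SHi B. [bookkeeping] -/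
def SHiB : Set (Fin 2 → ℝ) := SHi ∩ sU4
/-- Auxiliary definition `SHiA` (§19j): SHi A. [bookkeeping] -/
def SHiA : Set (Fin 2 → ℝ) := SHi ∩ sU4c
/-- Auxiliary definition `AngHSHi` (§19j): Ang HSHi. [bookkeeping] -/
def AngHSHi : KZ.IntegralRep 2 := AngH.rep.restrict SHi isSemialgebraic_SHi (fun _ hz => hz.1)
/-- Auxiliary definition `AngHSHiB` (§19j): Ang HSHi B. [bookkeeping] -/
def AngHSHiB : KZ.IntegralRep 2 :=
  AngH.rep.restrict SHiB (isSemialgebraic_SHi.inter isSemialgebraic_sU4) (fun _ hz => hz.1.1)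
/-- Auxiliary definition `AngHSHiA` (§19j): Ang HSHi A. [bookkeeping] -/
def AngHSHiA : KZ.IntegralRep 2 :=
  AngH.rep.restrict SHiA (isSemialgebraic_SHi.inter isSemialgebraic_sU4c) (fun _ hz => hz.1.1)

/-- Auxiliary step `volume_curve` (§19j): volume curve. [bookkeeping] -/
theorem volume_curve : MeasureTheory.volume
    {z : Fin 2 → ℝ | (4 * z 1 - 2) * (4 * z 1 - 2) * (1 + 8 * z 0 * z 0) = 1} = 0 := by
  have h := volume_setOf_aeval_eq_zero (k := ℚ) (m := 2)
    ((C 4 * X 1 - C 2) * (C 4 * X 1 - C 2) * (C 1 + C 8 * X 0 * X 0) - C 1 : MvPolynomial (Fin 2) ℚ) (by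
    intro h0
    have h1 := congr_arg (MvPolynomial.eval (fun _ => (0:ℝ))) h0
    simp at h1
    norm_num at h1)
  have e : {x : Fin 2 → ℝ | aeval x ((C 4 * X 1 - C 2) * (C 4 * X 1 - C 2) * (C 1 + C 8 * X 0 * X 0) - C 1 :
      MvPolynomial (Fin 2) ℚ) = 0} =
      {z : Fin 2 → ℝ | (4 * z 1 - 2) * (4 * z 1 - 2) * (1 + 8 * z 0 * z 0) = 1} := by
    ext z
    simp only [mem_setOf_eq, map_sub, map_mul, map_add, aeval_C, aeval_X, eq_ratCast, Rat.cast_ofNat,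
      Rat.cast_one, sub_eq_zero]
  rw [← e]; exact h

/-- the curve cut `[AngH | S'_hi] ≡ [AngH | S'_hi ∩ {below}] + [AngH | S'_hi ∩ {above}]`. -/
theorem AngHSHi_cut : KZ.of AngHSHi - KZ.of AngHSHiB - KZ.of AngHSHiA ∈ KZ.relations :=
  rel_cut AngHSHi AngHSHiB AngHSHiA (fun z => (4 * z 1 - 2) * (4 * z 1 - 2) * (1 + 8 * z 0 * z 0)) 1 rfl rfl
    volume_curve (fun _ _ => rfl) (fun _ _ => rfl)

/-- `S'_hi ∩ {below the curve} = U₋'⁺ ∩ {7P'² ≥ 1}` — uses `κ'(φ') ≤ 2α₁ ≤ φ' + α₁` for `φ' ≥ α₁`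
(tight at the corner `(α₁, 2α₁)`). -/
theorem SHiB_eq_UMhi : SHiB = UMhi := by
  ext z
  constructor
  · rintro ⟨⟨hc, ⟨⟨⟨r1, r2⟩, u2⟩, i3⟩⟩, u4⟩
    have h0 := (cube2 hc).1
    simp only [sRM1, sRM2, sU2m, sI3, sU4, mem_setOf_eq] at r1 r2 u2 i3 u4
    have hp : (0:ℝ) ≤ 2 * z 0 := by linarith [h0.1]
    have hQ0 : (0:ℝ) ≤ 4 * z 1 - 2 := by linarith
    have hQsq : (4 * z 1 - 2) * (4 * z 1 - 2) ≤ 1 := by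
      nlinarith [u4, mul_nonneg (mul_self_nonneg (4 * z 1 - 2)) (mul_self_nonneg (z 0))]
    have hq1 : 4 * z 1 - 2 ≤ (1:ℝ) := by nlinarith [mul_self_nonneg (4 * z 1 - 2 - 1)]
    have h7 : (1:ℝ) ≤ 7 * ((2 * z 0) * (2 * z 0)) := by linarith
    have h4 : (4 * z 1 - 2) * (4 * z 1 - 2) * (1 + 2 * ((2 * z 0) * (2 * z 0))) ≤ 1 := by nlinarith [u4]
    refine ⟨⟨hc, ⟨⟨⟨?_, u2⟩, ?_⟩, u4⟩⟩, r1⟩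
    · simp only [sU1, mem_setOf_eq]; linarith
    · simp only [sU3, mem_setOf_eq]
      nlinarith [mul_nonneg hp (sub_nonneg.2 u2), mul_nonneg hp hp, mul_nonneg (sub_nonneg.2 u2) (sub_nonneg.2 hq1),
        mul_nonneg (sub_nonneg.2 h7) (sub_nonneg.2 hq1), mul_nonneg (sub_nonneg.2 h4) hp,
        mul_nonneg (sub_nonneg.2 h7) hp, mul_nonneg (sub_nonneg.2 h7) (sub_nonneg.2 u2),
        mul_self_nonneg ((2 * z 0) * (4 * z 1 - 2)), mul_nonneg (sub_nonneg.2 h4) (sub_nonneg.2 u2)]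
  · rintro ⟨⟨hc, ⟨⟨⟨u1, u2⟩, u3⟩, u4⟩⟩, k2⟩
    have h0 := (cube2 hc).1
    simp only [sU1, sU2m, sU4, sK2c, mem_setOf_eq] at u1 u2 u4 k2
    have hp : (0:ℝ) ≤ 2 * z 0 := by linarith [h0.1]
    have hQ0 : (0:ℝ) ≤ 4 * z 1 - 2 := by linarith
    refine ⟨⟨hc, ⟨⟨⟨k2, ?_⟩, u2⟩, ?_⟩⟩, u4⟩
    · simp only [sRM2, mem_setOf_eq]
      nlinarith [mul_nonneg hp (sub_nonneg.2 u2), mul_nonneg (mul_nonneg hQ0 hQ0) (mul_self_nonneg (z 0)),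
        mul_nonneg hQ0 (sub_nonneg.2 u2)]
    · simp only [sI3, mem_setOf_eq]
      nlinarith [mul_nonneg (mul_nonneg hQ0 hQ0) (mul_self_nonneg (z 0))]

/-- `S'_hi ∩ {above the curve} = RM_cap' ∩ {Q' ≥ P'}`. -/
theorem SHiA_eq_RMcapU : SHiA = RMcapU := by
  ext z
  constructor
  · rintro ⟨⟨hc, ⟨⟨⟨r1, r2⟩, u2⟩, i3⟩⟩, a4⟩
    have h0 := (cube2 hc).1
    simp only [sRM1, sRM2, sU2m, sI3, sU4c, mem_setOf_eq] at r1 r2 u2 i3 a4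
    have hQ0 : (0:ℝ) ≤ 4 * z 1 - 2 := by linarith [h0.1]
    refine ⟨⟨hc, ⟨⟨⟨⟨r1, r2⟩, i3⟩, ?_⟩, ?_⟩⟩, ?_⟩
    · simp only [sI4, mem_setOf_eq]; nlinarith [a4]
    · simp only [sI5, mem_setOf_eq]
      nlinarith [mul_nonneg hQ0 hQ0, mul_nonneg (mul_nonneg hQ0 hQ0) (sub_nonneg.2 r2),
        mul_nonneg (mul_self_nonneg (z 0)) (mul_nonneg hQ0 hQ0)]
    · simp only [sDu, mem_setOf_eq]; linarith
  · rintro ⟨⟨hc, ⟨⟨⟨⟨r1, r2⟩, i3⟩, i4⟩, i5⟩⟩, du⟩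
    simp only [sRM1, sRM2, sI3, sI4, sI5, sDu, mem_setOf_eq] at r1 r2 i3 i4 i5 du
    refine ⟨⟨hc, ⟨⟨⟨r1, r2⟩, ?_⟩, i3⟩⟩, ?_⟩
    · simp only [sU2m, mem_setOf_eq]; linarith
    · simp only [sU4c, mem_setOf_eq]; nlinarith [i4]

/-- Auxiliary step `AngHSHiB_UMhi` (§19j): Ang HSHi B UMhi. [bookkeeping] -/
theorem AngHSHiB_UMhi : KZ.of AngHSHiB - KZ.of AngHUmhi ∈ KZ.relations :=
  KZ.of_sub_of_mem_relations_of_eqOn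
    (by simp only [AngHSHiB, AngHUmhi, KZ.IntegralRep.domain_restrict, SHiB_eq_UMhi]) (fun _ _ => rfl)
/-- Auxiliary step `AngHSHiA_RMcapU` (§19j): Ang HSHi A RMcap U. [bookkeeping] -/
theorem AngHSHiA_RMcapU : KZ.of AngHSHiA - KZ.of AngHMcapU ∈ KZ.relations :=
  KZ.of_sub_of_mem_relations_of_eqOn
    (by simp only [AngHSHiA, AngHMcapU, KZ.IntegralRep.domain_restrict, SHiA_eq_RMcapU]) (fun _ _ => rfl)

end Fold
end Summit.KontsevichZagierPeriods.RootDecompQuadraticDescent.Pair18Homotopy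
end
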